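import Mathlib
import Summits.Ventures.Crystal3D.Theorems.StickyWulffConstantStackingLiminfLayerChainV4Defs
import Summits.Ventures.Crystal3D.Theorems.StickyWulffConstantStackingLiminfMollifierSmooth
import Summits.Ventures.Crystal3D.Theorems.StickyWulffConstantStackingLiminfRungSmoothMass
import Summits.Ventures.Crystal3D.Theorems.StickyWulffConstantStackingLiminfPlateauProfile
import HarnessLib

/-!
# S2 of stub (B) `MollifiedUpper` (line LayerChain v4, crux `StackingLiminf`, stmt-Ventures-19145):
# the first-order TAYLOR remainder of the bump in `L¹`, with the rate `K⁻²`

Cell `crystal3d-full`, venture `Summits/Ventures/Crystal3D`.  BLUEPRINT-v4B (S2): replacing the finite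
difference `φ_K(y − b) − φ_K(y)` of the explicit `C²` bump `φ_K = bump K` by `−∂_b φ_K(y)` costs, in `L¹`,
at most `C‖b‖²/K²` per bump, uniformly in `K ≥ 1`, `‖b‖ ≤ 1`:
* `exists_taylor_const_bump_one` — for the FIXED function `φ_1` (C² with compact support, so `∇φ_1` is
  Lipschitz by `ContDiff.lipschitzWith_of_hasCompactSupport`): `|φ_1(x+v) − φ_1(x) − Dφ_1(x)v| ≤ M‖v‖²`
  (mean value inequality against the fixed linear map `Dφ_1(x)` on the ball of radius `‖v‖`);
* `bump_eq_scale`, `fderiv_bump_apply_eq_scale` — the scaling `φ_K(u) = K⁻³ φ_1(u/K)`,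
  `Dφ_K(y)b = K⁻³ Dφ_1(y/K)(b/K)`;
* `abs_taylor_bump_le` — hence `|φ_K(y−b) − φ_K(y) + Dφ_K(y)b| ≤ M‖b‖²/K⁵`, and it vanishes for
  `‖y‖ > K + ‖b‖` (`taylor_bump_eq_zero`);
* `integral_abs_taylor_bump_le` — `∫ |φ_K(·−b) − φ_K + Dφ_K(·)b| ≤ 64 M ‖b‖²/K²` for `‖b‖ ≤ 1 ≤ K`
  (sup-norm ball of radius `K + ‖b‖ ≤ 2K`, volume `(4K)³`);
* `integral_abs_sum_taylor_bump_le` — summed over a finite set of centres: `≤ #P · 64M‖b‖²/K²`.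
The constant `M` is existential (absolute); stub (B)'s `C₀` is existential too.
WHAT THIS IS NOT: stub (B); rung F-C1 not moved.
-/

noncomputable section

namespace Summit.Ventures.Crystal3D.Theorems

open MeasureTheory Set Function Metric Filter Topology
open Summit.Ventures.Crystal3D.LayerChain (dot3)
open Summit.Ventures.Crystal3D.Cruxes.StackingLiminf.LayerChainV4 (bump bumpConst)

/-- **Second-order Taylor bound for the unit bump** (absolute constant): `∇φ_1` is Lipschitz, so
`|φ_1(x + v) − φ_1(x) − Dφ_1(x) v| ≤ M ‖v‖²`. -/
theorem exists_taylor_const_bump_one : ∃ M : ℝ, 0 ≤ M ∧ ∀ x v : Fin 3 → ℝ,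
    |bump 1 (x + v) - bump 1 x - fderiv ℝ (bump 1) x v| ≤ M * ‖v‖ ^ 2 := by
  have h2 : ContDiff ℝ 2 (bump 1) := contDiff_bump 1
  have h1 : ContDiff ℝ 1 (fderiv ℝ (bump 1)) := h2.fderiv_right (m := 1) (by norm_num)
  have hs : HasCompactSupport (fderiv ℝ (bump 1)) := (hasCompactSupport_bump one_pos).fderiv (𝕜 := ℝ)
  obtain ⟨C, hC⟩ := h1.lipschitzWith_of_hasCompactSupport hs one_ne_zero
  refine ⟨C, C.2, fun x v => ?_⟩
  have hdiff : ∀ z ∈ closedBall x ‖v‖, DifferentiableAt ℝ (bump 1) z :=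
    fun z _ => (h2.differentiable (by norm_num)).differentiableAt
  have hbound : ∀ z ∈ closedBall x ‖v‖, ‖fderiv ℝ (bump 1) z - fderiv ℝ (bump 1) x‖ ≤ C * ‖v‖ := by
    intro z hz
    rw [mem_closedBall] at hz
    calc ‖fderiv ℝ (bump 1) z - fderiv ℝ (bump 1) x‖ = dist (fderiv ℝ (bump 1) z) (fderiv ℝ (bump 1) x) :=
          (dist_eq_norm _ _).symm
      _ ≤ C * dist z x := hC.dist_le_mul z x
      _ ≤ C * ‖v‖ := mul_le_mul_of_nonneg_left hz C.2
  have h := (convex_closedBall x ‖v‖).norm_image_sub_le_of_norm_fderiv_le' hdiff hbound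
    (mem_closedBall_self (norm_nonneg v)) (y := x + v) (by simp [mem_closedBall])
  rw [Real.norm_eq_abs] at h
  simpa [sq, mul_assoc] using h

/-- Scaling of the bump: `φ_K(u) = K⁻³ φ_1(u / K)`. -/
theorem bump_eq_scale {K : ℝ} (hK : K ≠ 0) (u : Fin 3 → ℝ) :
    bump K u = (K ^ 3)⁻¹ * bump 1 (K⁻¹ • u) := by
  unfold bump
  have hd : dot3 (K⁻¹ • u) (K⁻¹ • u) = dot3 u u / K ^ 2 := by
    simp only [dot3, Pi.smul_apply, smul_eq_mul]
    field_simp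
  rw [hd]
  simp only [one_pow, div_one]
  ring

/-- Scaling of the derivative of the bump: `Dφ_K(y) b = K⁻³ Dφ_1(y/K)(b/K)`. -/
theorem fderiv_bump_apply_eq_scale {K : ℝ} (hK : 0 < K) (y b : Fin 3 → ℝ) :
    fderiv ℝ (bump K) y b = (K ^ 3)⁻¹ * fderiv ℝ (bump 1) (K⁻¹ • y) (K⁻¹ • b) := by
  have hfun : bump K = fun u => (K ^ 3)⁻¹ * bump 1 (K⁻¹ • u) := by
    funext u; exact bump_eq_scale hK.ne' u
  have hsc : HasFDerivAt (fun u : Fin 3 → ℝ => K⁻¹ • u) (K⁻¹ • ContinuousLinearMap.id ℝ (Fin 3 → ℝ)) y :=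
    (hasFDerivAt_id (𝕜 := ℝ) y).const_smul K⁻¹
  have hb1 : HasFDerivAt (bump 1) (fderiv ℝ (bump 1) (K⁻¹ • y)) (K⁻¹ • y) :=
    ((contDiff_bump 1).differentiable (by norm_num)).differentiableAt.hasFDerivAt
  have hcomp := (hb1.comp y hsc).const_mul ((K ^ 3)⁻¹)
  have : HasFDerivAt (bump K) (((K ^ 3)⁻¹ : ℝ) • (fderiv ℝ (bump 1) (K⁻¹ • y)).comp
      (K⁻¹ • ContinuousLinearMap.id ℝ (Fin 3 → ℝ))) y := by
    rw [hfun]; exact hcomp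
  rw [this.fderiv]
  simp [map_smul]

/-- The closed support of the bump lies in the (sup-norm) ball of radius `K`. -/
theorem tsupport_bump_subset {K : ℝ} (hK : 0 < K) : tsupport (bump K) ⊆ closedBall (0 : Fin 3 → ℝ) K := by
  refine closure_minimal (fun u hu => ?_) isClosed_closedBall
  rw [mem_closedBall, dist_zero_right]
  by_contra h
  rw [not_le] at h
  obtain ⟨j, hj⟩ : ∃ j : Fin 3, K < |u j| := by
    by_contra h'
    push Not at h'
    have : ‖u‖ ≤ K := (pi_norm_le_iff_of_nonneg hK.le).2 fun j => by
      rw [Real.norm_eq_abs]; exact h' j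
    linarith
  exact hu (bump_eq_zero_of_coord hK j hj.le)

/-- Outside the ball of radius `K` the derivative of the bump vanishes. -/
theorem fderiv_bump_eq_zero {K : ℝ} (hK : 0 < K) {y : Fin 3 → ℝ} (hy : K < ‖y‖) :
    fderiv ℝ (bump K) y = 0 := by
  have hnot : y ∉ tsupport (bump K) := by
    intro h
    have := tsupport_bump_subset hK h
    rw [mem_closedBall, dist_zero_right] at this
    linarith
  exact notMem_support.mp fun h => hnot (support_fderiv_subset ℝ h)

/-- **Pointwise Taylor bound for `φ_K`**: with the constant `M` of `exists_taylor_const_bump_one`,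
`|φ_K(y − b) − φ_K(y) + Dφ_K(y) b| ≤ M ‖b‖² / K⁵`. -/
theorem abs_taylor_bump_le {M : ℝ}
    (hM : ∀ x v : Fin 3 → ℝ, |bump 1 (x + v) - bump 1 x - fderiv ℝ (bump 1) x v| ≤ M * ‖v‖ ^ 2)
    {K : ℝ} (hK : 0 < K) (y b : Fin 3 → ℝ) :
    |bump K (y - b) - bump K y + fderiv ℝ (bump K) y b| ≤ M * ‖b‖ ^ 2 / K ^ 5 := by
  rw [bump_eq_scale hK.ne' (y - b), bump_eq_scale hK.ne' y, fderiv_bump_apply_eq_scale hK y b]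
  have h := hM (K⁻¹ • y) (-(K⁻¹ • b))
  have e1 : K⁻¹ • (y - b) = K⁻¹ • y + -(K⁻¹ • b) := by rw [smul_sub, sub_eq_add_neg]
  rw [e1]
  have hK3 : 0 < (K ^ 3)⁻¹ := by positivity
  have e2 : (K ^ 3)⁻¹ * bump 1 (K⁻¹ • y + -(K⁻¹ • b)) - (K ^ 3)⁻¹ * bump 1 (K⁻¹ • y) +
      (K ^ 3)⁻¹ * (fderiv ℝ (bump 1) (K⁻¹ • y)) (K⁻¹ • b) =
      (K ^ 3)⁻¹ * (bump 1 (K⁻¹ • y + -(K⁻¹ • b)) - bump 1 (K⁻¹ • y) -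
        (fderiv ℝ (bump 1) (K⁻¹ • y)) (-(K⁻¹ • b))) := by
    rw [map_neg]; ring
  rw [e2, abs_mul, abs_of_pos hK3]
  have hn : ‖-(K⁻¹ • b)‖ = K⁻¹ * ‖b‖ := by
    rw [norm_neg, norm_smul, Real.norm_eq_abs, abs_of_pos (inv_pos.2 hK)]
  rw [hn] at h
  calc (K ^ 3)⁻¹ * |bump 1 (K⁻¹ • y + -(K⁻¹ • b)) - bump 1 (K⁻¹ • y) -
        (fderiv ℝ (bump 1) (K⁻¹ • y)) (-(K⁻¹ • b))|
      ≤ (K ^ 3)⁻¹ * (M * (K⁻¹ * ‖b‖) ^ 2) := mul_le_mul_of_nonneg_left h hK3.le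
    _ = M * ‖b‖ ^ 2 / K ^ 5 := by field_simp

/-- The Taylor remainder of `φ_K` vanishes outside the (sup-norm) ball of radius `K + ‖b‖`. -/
theorem taylor_bump_eq_zero {K : ℝ} (hK : 0 < K) {y b : Fin 3 → ℝ} (hy : K + ‖b‖ < ‖y‖) :
    bump K (y - b) - bump K y + fderiv ℝ (bump K) y b = 0 := by
  have h1 : K < ‖y‖ := by linarith [norm_nonneg b]
  have h2 : K < ‖y - b‖ := by
    have := norm_sub_norm_le y b
    have : ‖y‖ - ‖b‖ ≤ ‖y - b‖ := by linarith [abs_norm_sub_norm_le y b, norm_sub_rev y b, this]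
    linarith
  rw [PlateauHeight.bump_eq_zero_of_norm hK h2, PlateauHeight.bump_eq_zero_of_norm hK h1, fderiv_bump_eq_zero hK h1]
  simp

/-- The Taylor remainder of `φ_K` is continuous. -/
theorem continuous_taylor_bump (K : ℝ) (b : Fin 3 → ℝ) :
    Continuous fun y : Fin 3 → ℝ => bump K (y - b) - bump K y + fderiv ℝ (bump K) y b :=
  (((continuous_bump K).comp (continuous_id.sub continuous_const)).sub (continuous_bump K)).add
    (((contDiff_bump K).continuous_fderiv (by norm_num)).clm_apply continuous_const)

/-- The Taylor remainder of `φ_K` is integrable. -/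
theorem integrable_taylor_bump {K : ℝ} (hK : 0 < K) (b : Fin 3 → ℝ) :
    Integrable fun y : Fin 3 → ℝ => bump K (y - b) - bump K y + fderiv ℝ (bump K) y b := by
  refine (continuous_taylor_bump K b).integrable_of_hasCompactSupport ?_
  refine HasCompactSupport.intro (isCompact_closedBall (0 : Fin 3 → ℝ) (K + ‖b‖)) fun y hy => ?_
  rw [mem_closedBall, dist_zero_right, not_le] at hy
  exact taylor_bump_eq_zero hK hy

/-- **`L¹` Taylor bound for `φ_K`**: for `‖b‖ ≤ 1 ≤ K`,
`∫ |φ_K(y − b) − φ_K(y) + Dφ_K(y) b| dy ≤ 64 M ‖b‖² / K²`. -/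
theorem integral_abs_taylor_bump_le {M : ℝ} (hM0 : 0 ≤ M)
    (hM : ∀ x v : Fin 3 → ℝ, |bump 1 (x + v) - bump 1 x - fderiv ℝ (bump 1) x v| ≤ M * ‖v‖ ^ 2)
    {K : ℝ} (hK : 1 ≤ K) {b : Fin 3 → ℝ} (hb : ‖b‖ ≤ 1) :
    ∫ y : Fin 3 → ℝ, |bump K (y - b) - bump K y + fderiv ℝ (bump K) y b| ≤ 64 * M * ‖b‖ ^ 2 / K ^ 2 := by
  have hK0 : 0 < K := lt_of_lt_of_le one_pos hK
  set c : ℝ := M * ‖b‖ ^ 2 / K ^ 5 with hc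
  have hc0 : 0 ≤ c := by positivity
  set B : Set (Fin 3 → ℝ) := closedBall (0 : Fin 3 → ℝ) (K + ‖b‖) with hB
  have hBvol : (volume B).toReal = (2 * (K + ‖b‖)) ^ 3 := by
    rw [hB, Real.volume_pi_closedBall _ (by positivity), Fintype.card_fin,
      ENNReal.toReal_ofReal (by positivity)]
  have hBfin : volume B < ⊤ := by rw [hB]; exact measure_closedBall_lt_top
  have hpt : ∀ y : Fin 3 → ℝ, |bump K (y - b) - bump K y + fderiv ℝ (bump K) y b| ≤
      B.indicator (fun _ => c) y := by
    intro y
    by_cases hy : y ∈ B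
    · rw [indicator_of_mem hy]; exact abs_taylor_bump_le hM hK0 y b
    · rw [indicator_of_notMem hy]
      rw [hB, mem_closedBall, dist_zero_right, not_le] at hy
      rw [taylor_bump_eq_zero hK0 hy, abs_zero]
  calc ∫ y : Fin 3 → ℝ, |bump K (y - b) - bump K y + fderiv ℝ (bump K) y b|
      ≤ ∫ y : Fin 3 → ℝ, B.indicator (fun _ => c) y := by
        refine integral_mono (integrable_taylor_bump hK0 b).abs ?_ hpt
        exact (integrable_indicator_iff isClosed_closedBall.measurableSet).2
          ((integrableOn_const_iff).2 (Or.inr hBfin))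
    _ = (volume B).toReal * c := by
        rw [integral_indicator_const _ isClosed_closedBall.measurableSet, smul_eq_mul, measureReal_def]
    _ = (2 * (K + ‖b‖)) ^ 3 * c := by rw [hBvol]
    _ ≤ (4 * K) ^ 3 * c := by
        apply mul_le_mul_of_nonneg_right _ hc0
        have : 2 * (K + ‖b‖) ≤ 4 * K := by linarith
        exact pow_le_pow_left₀ (by positivity) this 3
    _ = 64 * M * ‖b‖ ^ 2 / K ^ 2 := by rw [hc]; field_simp; ring

/-- **`L¹` Taylor bound for a sum of translated bumps**: for a finite set of centres `P`, `‖b‖ ≤ 1 ≤ K`,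
`∫ |Σ_{p∈P} (φ_K(y − b − p) − φ_K(y − p) + Dφ_K(y − p) b)| dy ≤ #P · 64 M ‖b‖² / K²`. -/
theorem integral_abs_sum_taylor_bump_le {M : ℝ} (hM0 : 0 ≤ M)
    (hM : ∀ x v : Fin 3 → ℝ, |bump 1 (x + v) - bump 1 x - fderiv ℝ (bump 1) x v| ≤ M * ‖v‖ ^ 2)
    {K : ℝ} (hK : 1 ≤ K) {b : Fin 3 → ℝ} (hb : ‖b‖ ≤ 1) (P : Finset (Fin 3 → ℝ)) :
    ∫ y : Fin 3 → ℝ, |∑ p ∈ P, (bump K (y - p - b) - bump K (y - p) + fderiv ℝ (bump K) (y - p) b)| ≤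
      (P.card : ℝ) * (64 * M * ‖b‖ ^ 2 / K ^ 2) := by
  have hK0 : 0 < K := lt_of_lt_of_le one_pos hK
  have hint : ∀ p : Fin 3 → ℝ, Integrable fun y : Fin 3 → ℝ =>
      bump K (y - p - b) - bump K (y - p) + fderiv ℝ (bump K) (y - p) b := by
    intro p
    have := (integrable_taylor_bump hK0 b).comp_sub_right p
    exact this
  calc ∫ y : Fin 3 → ℝ, |∑ p ∈ P, (bump K (y - p - b) - bump K (y - p) + fderiv ℝ (bump K) (y - p) b)|
      ≤ ∫ y : Fin 3 → ℝ, ∑ p ∈ P, |bump K (y - p - b) - bump K (y - p) + fderiv ℝ (bump K) (y - p) b| :=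
        integral_mono (integrable_finsetSum _ fun p _ => hint p).abs
          (integrable_finsetSum _ fun p _ => (hint p).abs) fun y => Finset.abs_sum_le_sum_abs _ _
    _ = ∑ p ∈ P, ∫ y : Fin 3 → ℝ, |bump K (y - p - b) - bump K (y - p) + fderiv ℝ (bump K) (y - p) b| :=
        integral_finsetSum _ fun p _ => (hint p).abs
    _ = ∑ p ∈ P, ∫ y : Fin 3 → ℝ, |bump K (y - b) - bump K y + fderiv ℝ (bump K) y b| := by
        refine Finset.sum_congr rfl fun p _ => ?_
        exact integral_sub_right_eq_self
          (fun y => |bump K (y - b) - bump K y + fderiv ℝ (bump K) y b|) p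
    _ ≤ ∑ p ∈ P, 64 * M * ‖b‖ ^ 2 / K ^ 2 :=
        Finset.sum_le_sum fun p _ => integral_abs_taylor_bump_le hM0 hM hK hb
    _ = (P.card : ℝ) * (64 * M * ‖b‖ ^ 2 / K ^ 2) := by rw [Finset.sum_const, nsmul_eq_mul]

end Summit.Ventures.Crystal3D.Theorems

end
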